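/- Width seat `ym-line-cbag-p1-w3` (prover-ym-line-cbag-p1-w3-g18-0), LINE 7b (`GlueballBandRecursion`, volume-comparison line), follow-up asked
by the LEAD (cell STATUS 2026-08-28T21:10:15Z): the tube-rate jet stub `ThermalFreeEnergyVolumeJets` DISCHARGED (from the LEAD's
`coldFreeEnergyVolumeJets_holds` through the dyadic telescoping of `…ThermalJetsOfColdJets`), the sharp-exponent jets, and the two REAL-COUPLING
finite-size statements they encode.  Sorry-free; `--supports stmt-QuantumFields-22957 --as helper`. -/
import Summits.QuantumFields.YangMills.Theorems.GlueballBandRecursionThermalJetsOfColdJets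
import Summits.QuantumFields.YangMills.Theorems.GlueballBandRecursionColdDoublingSmallCoupling
import HarnessLib

/-!
# Route `GlueballBandRecursion`, line 7b: the thermal jet stub holds; finite-size independence of the torus free-energy densities

* §1 `thermalFreeEnergyVolumeJets_holds : ThermalFreeEnergyVolumeJets` — BOTH typed jet stubs of `…ThermalFreeEnergyDefs` are now theorems
  (`coldFreeEnergyVolumeJets_holds`, LEAD, `…ColdDoublingSmallCoupling`; this file), so the tube-rate assembly `…VolumeComparisonOfJets` fires as
  well as the finite one.
* §2 SHARP EXPONENT, every continuous `ρ`: `coldVolumeDiscrepancy ρ a a' T =O[𝓝 0] z^{4(a−1)+1}` (the LEAD's whole-disc bound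
  `48T·(‖z‖/(e r_ρ))^{4(a−1)+1}`), hence by dyadic telescoping `volumeDiscrepancy ρ a a' t =O[𝓝 0] z^{4(a−1)+1}` and the explicit PERIOD-FREE
  half-disc bound `‖volumeDiscrepancy ρ a a' t z‖ ≤ 288e·(‖z‖/(r_ρ/2))^{4(a−1)+1}` (`4 ≤ a ≤ a'`, `4 ≤ t`, `‖z‖ ≤ r_ρ/2`).
* §3 REAL COUPLING (unitary continuous `ρ`, all volumes `4 ≤ a ≤ a'`, periods `m + 2 ≥ 4`):
  - thermal free-energy density, half window `0 ≤ β ≤ r_ρ/2`: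
    `|log(1 + x_{m+2}(a'))/a'³ − log(1 + x_{m+2}(a))/a³| ≤ 288e·(2β/r_ρ)^{4a−3}` (`x = traceExcess`);
  - cold log-defect density, WHOLE window `0 ≤ β ≤ r_ρ`:
    `|log(Z_β(a'³×2(m+2))/Z_β(a'³×(m+2))²)/a'³ − log(Z_β(a³×2(m+2))/Z_β(a³×(m+2))²)/a³| ≤ 48(m+2)·(β/(e r_ρ))^{4a−3}` (`Z = wilsonFinTorusPartition`).
  In words: on the strong-coupling window the finite-size dependence of the torus thermal free-energy density and of the cold period-doubling
  log-defect density is `O(β^{4a−3})` with explicit, volume-free constants — closed plaquette families that feel the spatial period have at least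
  `4a − 3` members (girth-4 slab count of the width seats).

HONEST FRAMING.  Strong-coupling (small `β`) statements of RECORD type; item ⟨stmt-QuantumFields-22957⟩ (the one-glueball band), the typed-window
rung `ColdDoublingRecursionStrongCoupling`, and a fortiori the Yang–Mills mass gap / the summit `YangMills` are NOT proved or advanced here.
-/

set_option autoImplicit false

noncomputable section

open Filter Topology Asymptotics MeasureTheory
open Literature.MathematicalPhysics.QuantumFieldTheory
open Literature.MathematicalPhysics.QuantumFieldTheory.Balaban1983to89.Missing

namespace Summit.QuantumFields.YangMills.Theorems.GlueballBandRecursion.Thermal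

/-! ## §1 The tube-rate jet stub holds -/

/-- **`ThermalFreeEnergyVolumeJets` — PROVED** (line 7b's stub #1 in the tube-rate currency): for every compact `G`, faithful unitary `r`,
`4 ≤ a ≤ a'`, `4 ≤ t`, `volumeDiscrepancy r.ρ a a' t =O[𝓝 0] z^{3a}` — from `coldFreeEnergyVolumeJets_holds` by dyadic telescoping
(`thermalFreeEnergyVolumeJets_of_coldJets`). -/
theorem thermalFreeEnergyVolumeJets_holds : ThermalFreeEnergyVolumeJets :=
  thermalFreeEnergyVolumeJets_of_coldJets coldFreeEnergyVolumeJets_holds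

/-! ## §2 The sharp exponent `4(a−1)+1`, for every continuous representation -/

section Sharp

variable {G : Type*} [Group G] [TopologicalSpace G] [IsTopologicalGroup G] [CompactSpace G] [MeasurableSpace G] [BorelSpace G]
  {n : ℕ} (ρ : G →* Matrix (Fin n) (Fin n) ℂ)

/-- `coldVolumeDiscrepancy ρ a a' T =O[𝓝 0] z^{4(a−1)+1}` for `4 ≤ a ≤ a'`, `4 ≤ T` (the LEAD's whole-disc bound `norm_coldVolumeDiscrepancy_le_pow`). -/
theorem isBigO_coldVolumeDiscrepancy_pow (hρ : Continuous ρ) {a a' T : ℕ} (ha : 4 ≤ a) (haa' : a ≤ a') (hT : 4 ≤ T) :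
    (fun z : ℂ => coldVolumeDiscrepancy ρ a a' T z) =O[𝓝 (0 : ℂ)] fun z : ℂ => z ^ (4 * (a - 1) + 1) := by
  have hr := strongCouplingRadius_pos ρ
  refine IsBigO.of_bound (48 * (T : ℝ) / (Real.exp 1 * strongCouplingRadius ρ) ^ (4 * (a - 1) + 1)) ?_
  filter_upwards [Metric.closedBall_mem_nhds (0 : ℂ) hr] with z hz
  rw [Metric.mem_closedBall, dist_zero_right] at hz
  refine (norm_coldVolumeDiscrepancy_le_pow ρ hρ ha haa' hT hz).trans (le_of_eq ?_)
  rw [norm_pow, div_pow]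
  ring

/-- **Thermal jets with the sharp exponent**: `volumeDiscrepancy ρ a a' t =O[𝓝 0] z^{4(a−1)+1}` for `4 ≤ a ≤ a'`, `4 ≤ t`. -/
theorem isBigO_volumeDiscrepancy_pow (hρ : Continuous ρ) {a a' t : ℕ} (ha : 4 ≤ a) (haa' : a ≤ a') (ht : 4 ≤ t) :
    (fun z : ℂ => volumeDiscrepancy ρ a a' t z) =O[𝓝 (0 : ℂ)] fun z : ℂ => z ^ (4 * (a - 1) + 1) :=
  isBigO_volumeDiscrepancy_of_cold ρ hρ (by omega) (by omega) (by omega) fun k =>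
    isBigO_coldVolumeDiscrepancy_pow ρ hρ ha haa' (le_mul_of_one_le_of_le Nat.one_le_two_pow ht)

/-- **Explicit, period-free half-disc bound**: `‖volumeDiscrepancy ρ a a' t z‖ ≤ 288e·(‖z‖/(r_ρ/2))^{4(a−1)+1}` for `‖z‖ ≤ r_ρ/2`
(`4 ≤ a ≤ a'`, `4 ≤ t`). -/
theorem norm_volumeDiscrepancy_le_pow (hρ : Continuous ρ) {a a' t : ℕ} (ha : 4 ≤ a) (haa' : a ≤ a') (ht : 4 ≤ t) {z : ℂ}
    (hz : ‖z‖ ≤ strongCouplingRadius ρ / 2) :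
    ‖volumeDiscrepancy ρ a a' t z‖ ≤ 288 * Real.exp 1 * (‖z‖ / (strongCouplingRadius ρ / 2)) ^ (4 * (a - 1) + 1) :=
  norm_volumeDiscrepancy_le_of_cold_isBigO ρ hρ (by omega) (by omega) (by omega)
    (fun k => isBigO_coldVolumeDiscrepancy_pow ρ hρ ha haa' (le_mul_of_one_le_of_le Nat.one_le_two_pow ht)) hz

end Sharp

/-! ## §3 Real coupling: finite-size independence of the torus free-energy densities -/

section RealCoupling

variable {G : Type*} [Group G] [TopologicalSpace G] [IsTopologicalGroup G] [CompactSpace G] [MeasurableSpace G] [BorelSpace G]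
  [SecondCountableTopology G] {n : ℕ} (ρ : G →* Matrix (Fin n) (Fin n) ℂ)

/-- **Finite-size independence of the thermal free-energy density (half window, all volumes).**  For a continuous unitary `ρ`,
`0 ≤ β ≤ r_ρ/2`, volumes `4 ≤ a ≤ a'` and period `m + 2 ≥ 4`:
`|log(1 + traceExcess ρ β a' (m+2))/a'³ − log(1 + traceExcess ρ β a (m+2))/a³| ≤ 288e·(β/(r_ρ/2))^{4(a−1)+1}`. -/
theorem abs_log_one_add_traceExcess_div_sub_le (hρ : Continuous ρ) (hρu : ∀ g, ρ g ∈ Matrix.unitaryGroup (Fin n) ℂ) {β : ℝ}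
    (hβ0 : 0 ≤ β) (hβ : β ≤ strongCouplingRadius ρ / 2) {a a' m : ℕ} [NeZero a] [NeZero a'] (ha : 4 ≤ a) (haa' : a ≤ a')
    (hm : 2 ≤ m) :
    |Real.log (1 + traceExcess ρ β a' (m + 2)) / (a' : ℝ) ^ 3 - Real.log (1 + traceExcess ρ β a (m + 2)) / (a : ℝ) ^ 3| ≤
      288 * Real.exp 1 * (β / (strongCouplingRadius ρ / 2)) ^ (4 * (a - 1) + 1) := by
  have hr := strongCouplingRadius_pos ρ
  have hβr : β ≤ strongCouplingRadius ρ := hβ.trans (half_le_self hr.le)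
  have hzn : ‖(β : ℂ)‖ = β := by rw [Complex.norm_real, Real.norm_eq_abs, abs_of_nonneg hβ0]
  rw [← re_volumeDiscrepancy_ofReal ρ hρ hρu hβ0 hβr a a' m]
  refine (Complex.abs_re_le_norm _).trans ?_
  have h := norm_volumeDiscrepancy_le_pow ρ hρ ha haa' (t := m + 2) (by omega) (z := (β : ℂ)) (by rw [hzn]; exact hβ)
  rwa [hzn] at h

/-- **Finite-size independence of the cold log-defect density (whole window, all volumes).**  For a continuous unitary `ρ`,
`0 ≤ β ≤ r_ρ`, volumes `4 ≤ a ≤ a'` and period `m + 2 ≥ 4`, with `Z_β(b³×T) = wilsonFinTorusPartition ρ β b b b T`: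
`|log(Z_β(a'³×2(m+2))/Z_β(a'³×(m+2))²)/a'³ − log(Z_β(a³×2(m+2))/Z_β(a³×(m+2))²)/a³| ≤ 48(m+2)·(β/(e r_ρ))^{4(a−1)+1}`
(real part of the LEAD's `norm_coldVolumeDiscrepancy_le_pow`). -/
theorem abs_log_coldRatio_div_sub_le (hρ : Continuous ρ) (hρu : ∀ g, ρ g ∈ Matrix.unitaryGroup (Fin n) ℂ) {β : ℝ}
    (hβ0 : 0 ≤ β) (hβ : β ≤ strongCouplingRadius ρ) {a a' m : ℕ} (ha : 4 ≤ a) (haa' : a ≤ a') (hm : 2 ≤ m) :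
    |Real.log (wilsonFinTorusPartition ρ β a' a' a' (2 * (m + 2)) / wilsonFinTorusPartition ρ β a' a' a' (m + 2) ^ 2) / (a' : ℝ) ^ 3 -
        Real.log (wilsonFinTorusPartition ρ β a a a (2 * (m + 2)) / wilsonFinTorusPartition ρ β a a a (m + 2) ^ 2) / (a : ℝ) ^ 3| ≤
      48 * ((m : ℝ) + 2) * (β / (Real.exp 1 * strongCouplingRadius ρ)) ^ (4 * (a - 1) + 1) := by
  haveI : NeZero a := ⟨by omega⟩
  haveI : NeZero a' := ⟨by omega⟩
  have hzn : ‖(β : ℂ)‖ = β := by rw [Complex.norm_real, Real.norm_eq_abs, abs_of_nonneg hβ0]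
  -- the real part of the cold volume discrepancy at real coupling
  have hre : (coldVolumeDiscrepancy ρ a a' (m + 2) (β : ℂ)).re =
      -(Real.log (wilsonFinTorusPartition ρ β a' a' a' (2 * (m + 2)) / wilsonFinTorusPartition ρ β a' a' a' (m + 2) ^ 2) / (a' : ℝ) ^ 3 -
        Real.log (wilsonFinTorusPartition ρ β a a a (2 * (m + 2)) / wilsonFinTorusPartition ρ β a a a (m + 2) ^ 2) / (a : ℝ) ^ 3) := by
    have e1 : ((a' : ℂ) ^ 3) = (((a' : ℝ) ^ 3 : ℝ) : ℂ) := by push_cast; ring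
    have e2 : ((a : ℂ) ^ 3) = (((a : ℝ) ^ 3 : ℝ) : ℂ) := by push_cast; ring
    unfold coldVolumeDiscrepancy
    rw [Complex.sub_re, e1, e2, Complex.div_ofReal_re, Complex.div_ofReal_re, re_coldLogDefect_ofReal ρ hρ hρu hβ0 hβ a m,
      re_coldLogDefect_ofReal ρ hρ hρu hβ0 hβ a' m]
    ring
  rw [← abs_neg, ← hre]
  refine (Complex.abs_re_le_norm _).trans ?_
  have h := norm_coldVolumeDiscrepancy_le_pow ρ hρ ha haa' (t := m + 2) (by omega) (z := (β : ℂ)) (by rw [hzn]; exact hβ)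
  rw [hzn] at h
  refine h.trans (le_of_eq ?_)
  push_cast
  ring

end RealCoupling

end Summit.QuantumFields.YangMills.Theorems.GlueballBandRecursion.Thermal

end
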